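import Mathlib.Analysis.Convolution
import Mathlib.Analysis.Calculus.ContDiff.Convolution
import Mathlib.Analysis.Calculus.BumpFunction.Convolution
import Mathlib.Analysis.Calculus.BumpFunction.FiniteDimension
import Literature.Analysis.FunctionSpaces.MollificationLp
import Literature.Analysis.FluidPDE.SpaceTimeRescaling
import Literature.Analysis.FluidPDE.WholeSpaceIBP
import Literature.Analysis.FluidPDE.LerayHopfProofs
import HarnessLib

/-!
# Space–time mollification of distributional Navier–Stokes solutions

Analysis/FluidPDE support file in the decomposition of the endpoint criterion
`Literature.Analysis.FluidPDE.ess_endpoint` (Escauriaza–Seregin–Šverák 2003): it serves the discharge of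
`NS.ess_suitable_of_L3infty'` ("`(1.15)`–`(1.16)` pairs are suitable; this can be verified with
the help of usual mollification", ESS, proof of Thm. 1.4) by making the *usual mollification*
available: for a distributional solution `(u, p)` of the unforced system on an open
`Q ⊆ ℝ × E` (accepted `Fluid.IsDistributionalNSSolutionOn`) the space–time mollifications
`V = k ⋆ 𝟙_Q u`, `N_e = k ⋆ 𝟙_Q (⟪u, e⟫ u)`, `P = k ⋆ 𝟙_Q p` by a smooth kernel `k` supported in
`closedBall 0 r` satisfy the equations **pointwise** at every `z₀` with `closedBall z₀ r ⊆ Q`: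
`⟪∂ₜV, e⟫ + div N_e - ν ⟪ΔV, e⟫ + ∂ₑP = 0`, `div V = 0`, and `D_x V = k ⋆ 𝟙_Q G` for a weak
spatial gradient `G` (Caffarelli–Kohn–Nirenberg 1982, §2; Evans, *PDE*, §5.3.1, Thm. 1).

## Contents

* kernel calculus on a finite-dimensional space with a Haar measure:
  `fderiv_convolution_lsmul_haar_apply` (`D(k ⋆ g) v = (∂ᵥk) ⋆ g`), locality
  `convolution_lsmul_congr_of_eqOn`, `inner_convolution_lsmul_apply`;
* slices of `H : ℝ × E → F`: `timeDeriv_curry_eq_fderiv`, `fderiv_slice_apply`,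
  `laplacian_slice_eq_sum`; scalar-times-constant fields (`timeDeriv_smul_const`,
  `convect_smul_const`, `divergence_smul_const`, `laplacian_smul_const`); the dyad
  `innerSmulBilin e x y = ⟪x, e⟫ • y`;
* `Fluid.reflect k t₀ x₀` — the reflected translate `(s, y) ↦ k(t₀ - s, x₀ - y)` (a space–time
  test function in the interior, `isSpaceTimeTestOn_reflect`) and its derivatives;
  `Fluid.spaceLaplacian k` — `Δ_y k`;
* `Fluid.stMollify k g` — the space–time mollification (curried), with
  `timeDeriv_stMollify`, `fderiv_stMollify_apply`, `laplacian_stMollify`,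
  `divergence_stMollify`; `Fluid.zeroExt Q f` — the zero extension `𝟙_Q f`;
* `IsDistributionalNSSolutionOn.mollified_momentum`,
  `IsDistributionalNSSolutionOn.divergence_mollified_eq_zero`,
  `HasWeakSpatialGradientOn.fderiv_mollified` — the mollified system (all proved).

## Mathlib search

Mathlib (this pin) has the convolution API with derivatives and smoothness under compactly
supported smooth kernels (`HasCompactSupport.hasFDerivAt_convolution_left`,
`HasCompactSupport.contDiff_convolution_left`), bump functions on finite-dimensional spaces
(`HasContDiffBump` instance of `BumpFunction/FiniteDimension`, used on `ℝ × E`), and the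
product Haar instance `Measure.prod.instIsAddHaarMeasure` (not found through `volume`, whence
the local instances below). It has no weak derivatives and no Navier–Stokes notions. The tree
has whole-space and interior mollification of weak derivatives for inner product spaces
(`FunctionSpaces/Mollification`, `MollificationLocal`; `HelmholtzAnnihilator` has
`Fluid.fderiv_convolution_lsmul_apply` for `volume` on an inner product space) — here the
domain is the plain product `ℝ × E`, so the kernel lemma is restated for a general Haar measure.

## References

* L. Caffarelli, R. Kohn, L. Nirenberg, *Partial regularity of suitable weak solutions of the
  Navier–Stokes equations*, CPAM 35 (1982), §2 (the mollified equations).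
* L. Escauriaza, G. Seregin, V. Šverák, *`L_{3,∞}`-solutions of Navier–Stokes equations and
  backward uniqueness*, Russ. Math. Surveys 58:2 (2003), §3, proof of Thm. 1.4, first paragraph.
* L. C. Evans, *Partial Differential Equations*, 2nd ed. (2010), App. C.4 and §5.3.1, Thm. 1.
-/

noncomputable section

open MeasureTheory TopologicalSpace Set Function Filter Topology ContinuousLinearMap Metric
  InnerProductSpace
open scoped ENNReal NNReal Convolution Laplacian RealInnerProductSpace

namespace Literature.Analysis.FluidPDE

open scoped ContDiff

/-! ### Smooth compactly supported kernels on a finite-dimensional space: derivatives of `k ⋆ g` -/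

/-- `2 ≤ ∞` in the smoothness exponents `WithTop ℕ∞`. [folklore] -/
theorem two_le_infty : (2 : WithTop ℕ∞) ≤ ((⊤ : ℕ∞) : WithTop ℕ∞) := by
  change ((2 : ℕ∞) : WithTop ℕ∞) ≤ ((⊤ : ℕ∞) : WithTop ℕ∞)
  exact_mod_cast le_top

/-- `1 ≤ ∞` in the smoothness exponents `WithTop ℕ∞`. [folklore] -/
theorem one_le_infty : (1 : WithTop ℕ∞) ≤ ((⊤ : ℕ∞) : WithTop ℕ∞) := by
  change ((1 : ℕ∞) : WithTop ℕ∞) ≤ ((⊤ : ℕ∞) : WithTop ℕ∞)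
  exact_mod_cast le_top

section Kernel

variable {G : Type*} [NormedAddCommGroup G] [NormedSpace ℝ G] [FiniteDimensional ℝ G]
  [MeasurableSpace G] [BorelSpace G] {μ : Measure G} [μ.IsAddHaarMeasure]
variable {F : Type*} [NormedAddCommGroup F] [NormedSpace ℝ F]

omit [FiniteDimensional ℝ G] [MeasurableSpace G] [BorelSpace G] in
/-- The directional derivatives `w ↦ Dk(w) v` of a `C^∞` kernel are `C^∞`. [folklore] -/
theorem contDiff_fderiv_apply_const {k : G → ℝ} (hk : ContDiff ℝ ∞ k) (v : G) :
    ContDiff ℝ ∞ fun w => fderiv ℝ k w v :=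
  (hk.fderiv_right (m := ∞) le_rfl).clm_apply contDiff_const

omit [FiniteDimensional ℝ G] [MeasurableSpace G] [BorelSpace G] in
/-- The directional derivatives of a compactly supported kernel are compactly supported. [folklore] -/
theorem hasCompactSupport_fderiv_apply_const {k : G → ℝ} (hk : HasCompactSupport k) (v : G) :
    HasCompactSupport fun w => fderiv ℝ k w v :=
  hk.fderiv_apply (𝕜 := ℝ) v

/-- **Differentiating under the convolution.** For a `C¹` compactly supported scalar kernel `k`
and a locally integrable `g`, the directional derivative of `k ⋆ g` along `v` is the convolution
with the differentiated kernel: `D(k ⋆ g)(z) v = ((∂ᵥ k) ⋆ g)(z)` (Mathlib's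
`HasCompactSupport.hasFDerivAt_convolution_left`, evaluated; Evans, *PDE*, App. C.4, Thm. 7). [folklore] -/
theorem fderiv_convolution_lsmul_haar_apply {k : G → ℝ} (hk : ContDiff ℝ 1 k) (hkc : HasCompactSupport k)
    {g : G → F} (hg : LocallyIntegrable g μ) (z v : G) :
    fderiv ℝ (k ⋆[lsmul ℝ ℝ, μ] g) z v = ((fun w => fderiv ℝ k w v) ⋆[lsmul ℝ ℝ, μ] g) z := by
  have hD := hkc.hasFDerivAt_convolution_left (lsmul ℝ ℝ) hk hg z
  have hint : ConvolutionExistsAt (fderiv ℝ k) g z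
      ((lsmul ℝ ℝ : ℝ →L[ℝ] F →L[ℝ] F).precompL G) μ :=
    (hkc.fderiv ℝ).convolutionExists_left _ (hk.continuous_fderiv one_ne_zero) hg z
  rw [hD.fderiv, convolution_def, ContinuousLinearMap.integral_apply hint.integrable v,
    convolution_def]
  simp only [precompL_apply, lsmul_apply]

/-- The convolution of a locally integrable function with a `C^∞` compactly supported scalar
kernel is `C^∞` (Mathlib `HasCompactSupport.contDiff_convolution_left`). [folklore] -/
theorem contDiff_convolution_lsmul {k : G → ℝ} (hk : ContDiff ℝ ∞ k) (hkc : HasCompactSupport k)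
    {g : G → F} (hg : LocallyIntegrable g μ) : ContDiff ℝ ∞ (k ⋆[lsmul ℝ ℝ, μ] g) :=
  hkc.contDiff_convolution_left _ hk hg

/-- The symmetric form of the scalar convolution: `(k ⋆ g)(z) = ∫ k(z - w) • g(w) dw`. [folklore] -/
theorem convolution_lsmul_apply_eq {k : G → ℝ} {g : G → F} (z : G) :
    (k ⋆[lsmul ℝ ℝ, μ] g) z = ∫ w, k (z - w) • g w ∂μ :=
  convolution_lsmul_swap

/-- **Locality of mollification**: if `k` vanishes outside the closed ball of radius `r` and
`g₁ = g₂` on `closedBall z r`, then `(k ⋆ g₁)(z) = (k ⋆ g₂)(z)`. [folklore] -/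
theorem convolution_lsmul_congr_of_eqOn {k : G → ℝ} {r : ℝ}
    (hk : ∀ w, w ∉ closedBall (0 : G) r → k w = 0) {g₁ g₂ : G → F} {z : G}
    (h : EqOn g₁ g₂ (closedBall z r)) :
    (k ⋆[lsmul ℝ ℝ, μ] g₁) z = (k ⋆[lsmul ℝ ℝ, μ] g₂) z := by
  rw [convolution_lsmul_apply_eq, convolution_lsmul_apply_eq]
  refine integral_congr_ae (Eventually.of_forall fun w => ?_)
  by_cases hw : w ∈ closedBall z r
  · simp only [h hw]
  · have : z - w ∉ closedBall (0 : G) r := by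
      intro h'
      apply hw
      rw [mem_closedBall, dist_comm, dist_eq_norm]
      simpa using h'
    simp only [hk _ this, zero_smul]

omit [NormedSpace ℝ G] [FiniteDimensional ℝ G] [BorelSpace G] [μ.IsAddHaarMeasure] in
/-- Inner products pass under the scalar convolution: `⟪(k ⋆ g)(z), c⟫ = (k ⋆ ⟪g, c⟫)(z)` when
the convolution exists at `z`. [folklore] -/
theorem inner_convolution_lsmul_apply {F' : Type*} [NormedAddCommGroup F'] [InnerProductSpace ℝ F']
    [CompleteSpace F'] {k : G → ℝ} {g : G → F'} {z : G}
    (h : ConvolutionExistsAt k g z (lsmul ℝ ℝ) μ) (c : F') :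
    ⟪(k ⋆[lsmul ℝ ℝ, μ] g) z, c⟫ = ((k ⋆[lsmul ℝ ℝ, μ] fun w => ⟪g w, c⟫) z : ℝ) := by
  rw [convolution_def, convolution_def, real_inner_comm, ← integral_inner h.integrable]
  refine integral_congr_ae (Eventually.of_forall fun w => ?_)
  simp only [lsmul_apply, real_inner_smul_right, real_inner_comm c, smul_eq_mul]

end Kernel

/-! ### Space–time slices: time derivative, spatial derivative and Laplacian of `H : ℝ × E → F` -/

section Slice

variable {E : Type*} [NormedAddCommGroup E] [InnerProductSpace ℝ E]
variable {F : Type*} [NormedAddCommGroup F] [NormedSpace ℝ F]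

/-- Time derivative of the curried field: `∂ₜ H(t, x) = DH(t, x)(1, 0)` at points of
differentiability. [folklore] -/
theorem timeDeriv_curry_eq_fderiv {H : ℝ × E → F} {t : ℝ} {x : E}
    (hH : DifferentiableAt ℝ H (t, x)) :
    timeDeriv (curry H) t x = fderiv ℝ H (t, x) (1, 0) := by
  rw [timeDeriv_apply]
  have h1 : HasDerivAt (fun s : ℝ => (s, x)) ((1 : ℝ), (0 : E)) t := by
    have := (hasDerivAt_id t).prodMk (hasDerivAt_const t x)
    simpa using this
  exact (hH.hasFDerivAt.comp_hasDerivAt t h1).deriv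

/-- Spatial derivative of a slice: `D(H(t, ·))(x) v = DH(t, x)(0, v)` at points of
differentiability. [folklore] -/
theorem fderiv_slice_apply {H : ℝ × E → F} {t : ℝ} {x : E}
    (hH : DifferentiableAt ℝ H (t, x)) (v : E) :
    fderiv ℝ (fun y => H (t, y)) x v = fderiv ℝ H (t, x) (0, v) := by
  have h : HasFDerivAt (fun y => H (t, y)) ((fderiv ℝ H (t, x)).comp (inr ℝ ℝ E)) x :=
    hH.hasFDerivAt.comp x (hasFDerivAt_prodMk_right (𝕜 := ℝ) t x)
  rw [h.fderiv]
  simp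

/-- Spatial derivative of a slice as a continuous linear map: `D(H(t, ·))(x) = DH(t, x) ∘ inr`. [folklore] -/
theorem fderiv_slice {H : ℝ × E → F} {t : ℝ} {x : E} (hH : DifferentiableAt ℝ H (t, x)) :
    fderiv ℝ (fun y => H (t, y)) x = (fderiv ℝ H (t, x)).comp (inr ℝ ℝ E) := by
  have h : HasFDerivAt (fun y => H (t, y)) ((fderiv ℝ H (t, x)).comp (inr ℝ ℝ E)) x :=
    hH.hasFDerivAt.comp x (hasFDerivAt_prodMk_right (𝕜 := ℝ) t x)
  exact h.fderiv

/-- Slices of `Cⁿ` space–time fields are `Cⁿ`. [folklore] -/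
theorem contDiff_slice {n : WithTop ℕ∞} {H : ℝ × E → F} (hH : ContDiff ℝ n H) (t : ℝ) :
    ContDiff ℝ n fun y => H (t, y) :=
  hH.comp (contDiff_prodMk_right t)

variable [FiniteDimensional ℝ E]

/-- **The Laplacian of a slice** in terms of second space–time directional derivatives:
`Δ (H(t, ·))(x) = Σᵢ ∂_{(0,bᵢ)} ∂_{(0,bᵢ)} H (t, x)` for `C²` fields and any orthonormal
basis `b` of `E`. [folklore] -/
theorem laplacian_slice_eq_sum {ι : Type*} [Fintype ι] (b : OrthonormalBasis ι ℝ E)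
    {F' : Type*} [NormedAddCommGroup F'] [InnerProductSpace ℝ F']
    {H : ℝ × E → F'} (hH : ContDiff ℝ 2 H) (t : ℝ) (x : E) :
    (Δ (fun y => H (t, y))) x =
      ∑ i, fderiv ℝ (fun w => fderiv ℝ H w (0, b i)) (t, x) (0, b i) := by
  rw [laplacian_eq_sum_fderiv_fderiv b (contDiff_slice hH t) x]
  refine Finset.sum_congr rfl fun i _ => ?_
  have hd : ∀ y, DifferentiableAt ℝ H (t, y) := fun y => hH.differentiable (by norm_num) _
  have h1 : (fun y => fderiv ℝ (fun y' => H (t, y')) y (b i)) =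
      fun y => (fun w => fderiv ℝ H w (0, b i)) (t, y) := by
    funext y
    exact fderiv_slice_apply (hd y) (b i)
  rw [h1]
  have hd2 : DifferentiableAt ℝ (fun w => fderiv ℝ H w (0, b i)) (t, x) :=
    (((hH.fderiv_right (m := 1) le_rfl).clm_apply contDiff_const).differentiable one_ne_zero) _
  exact fderiv_slice_apply hd2 (b i)

end Slice


/-! ### Pointwise vector calculus for scalar-times-constant fields -/

section SmulConst

variable {E : Type*} [NormedAddCommGroup E] [InnerProductSpace ℝ E] [FiniteDimensional ℝ E]
variable {F' : Type*} [NormedAddCommGroup F'] [InnerProductSpace ℝ F']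

omit [NormedAddCommGroup E] [InnerProductSpace ℝ E] [FiniteDimensional ℝ E] in
/-- Time derivative of `θ • c` for a constant vector `c`: `∂ₜ(θ c) = (∂ₜθ) c` (at points of
differentiability in time). [folklore] -/
theorem timeDeriv_smul_const (θ : ℝ → E → ℝ) (c : F') {s : ℝ} {y : E}
    (hθ : DifferentiableAt ℝ (fun s => θ s y) s) :
    timeDeriv (fun s y => θ s y • c) s y = timeDeriv θ s y • c := by
  simp only [timeDeriv_apply]
  exact deriv_smul_const hθ c

omit [FiniteDimensional ℝ E] in
/-- Convective derivative of `θ • c` for a constant vector `c`: `(u·∇)(θ c) = (Dθ u) c`. [folklore] -/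
theorem convect_smul_const {θ : E → ℝ} (u : E → E) (c : F') {x : E}
    (hθ : DifferentiableAt ℝ θ x) :
    convect u (fun y => θ y • c) x = (fderiv ℝ θ x (u x)) • c := by
  rw [convect_smul_apply hθ (differentiableAt_const (𝕜 := ℝ) c)]
  simp [convect]

/-- Divergence of `θ • c` for a constant vector `c`: `div (θ c) = Dθ(c)`. [folklore] -/
theorem divergence_smul_const {θ : E → ℝ} (c : E) {x : E} (hθ : DifferentiableAt ℝ θ x) :
    VectorCalculus.divergence (fun y => θ y • c) x = fderiv ℝ θ x c := by
  rw [divergence_smul_apply hθ (differentiableAt_const (𝕜 := ℝ) c)]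
  have h0 : VectorCalculus.divergence (fun _ : E => c) x = 0 := by
    simp [VectorCalculus.divergence]
  rw [h0, mul_zero, zero_add, gradient, real_inner_comm, InnerProductSpace.toDual_symm_apply]

/-- Laplacian of `θ • c` for a constant vector `c` and `C²` scalar `θ`: `Δ(θ c) = (Δθ) c`. [folklore] -/
theorem laplacian_smul_const {θ : E → ℝ} (hθ : ContDiff ℝ 2 θ) (c : F') (x : E) :
    (Δ (fun y => θ y • c)) x = (Δ θ) x • c := by
  set b := stdOrthonormalBasis ℝ E
  have hθc : ContDiff ℝ 2 (fun y => θ y • c) := hθ.smul contDiff_const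
  rw [laplacian_eq_sum_fderiv_fderiv b hθc x, laplacian_eq_sum_fderiv_fderiv b hθ x,
    Finset.sum_smul]
  refine Finset.sum_congr rfl fun i _ => ?_
  have hd : ∀ y, DifferentiableAt ℝ θ y := fun y => hθ.differentiable (by norm_num) y
  have h1 : (fun y => fderiv ℝ (fun y' => θ y' • c) y (b i)) = fun y => fderiv ℝ θ y (b i) • c := by
    funext y
    rw [fderiv_smul_const (hd y)]
    simp
  rw [h1]
  have hd2 : DifferentiableAt ℝ (fun y => fderiv ℝ θ y (b i)) x :=
    (((hθ.fderiv_right (m := 1) le_rfl).clm_apply contDiff_const).differentiable one_ne_zero) x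
  rw [fderiv_smul_const hd2]
  simp

/-- The bilinear map `(x, y) ↦ ⟪x, e⟫ • y` (the dyad `⟪·, e⟫ ⊗ ·`, used for the transport
term `(uᵢ u)` of the mollified system). [folklore] -/
def innerSmulBilin (e : E) : E →L[ℝ] E →L[ℝ] E :=
  ((ContinuousLinearMap.lsmul ℝ ℝ).bilinearComp (innerSL ℝ e) (ContinuousLinearMap.id ℝ E))

omit [FiniteDimensional ℝ E] in
/-- Unfolding `innerSmulBilin`. [folklore] -/
@[simp]
theorem innerSmulBilin_apply (e x y : E) : innerSmulBilin e x y = ⟪x, e⟫ • y := by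
  simp [innerSmulBilin, real_inner_comm]

end SmulConst

/-! ### Reflected translates of space–time kernels -/

section Reflect

variable {E : Type*} [NormedAddCommGroup E] [InnerProductSpace ℝ E]
variable {F' : Type*} [NormedAddCommGroup F'] [InnerProductSpace ℝ F']

/-- The reflected translate `(s, y) ↦ k(t₀ - s, x₀ - y)` of a space–time kernel `k`, as a curried
space–time field (the test function `η_ε(z₀ - ·)` of Evans, *PDE*, App. C.4). [folklore] -/
def reflect (k : ℝ × E → ℝ) (t₀ : ℝ) (x₀ : E) : ℝ → E → ℝ :=
  fun s y => k (t₀ - s, x₀ - y)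

omit [InnerProductSpace ℝ E] in
/-- Unfolding `reflect`. [folklore] -/
@[simp]
theorem reflect_apply (k : ℝ × E → ℝ) (t₀ : ℝ) (x₀ : E) (s : ℝ) (y : E) :
    reflect k t₀ x₀ s y = k (t₀ - s, x₀ - y) :=
  rfl

omit [InnerProductSpace ℝ E] in
/-- `uncurry (reflect k t₀ x₀) = k ((t₀, x₀) - ·)`. [folklore] -/
theorem uncurry_reflect (k : ℝ × E → ℝ) (t₀ : ℝ) (x₀ : E) :
    uncurry (reflect k t₀ x₀) = fun w => k ((t₀, x₀) - w) := by
  funext w; rfl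

/-- The reflected translate is the pull-back along `(s, y) ↦ (t₀ - s, x₀ - y)`, i.e.
`stPull (-1) (-1) t₀ x₀`. [folklore] -/
theorem reflect_eq_stPull (k : ℝ × E → ℝ) (t₀ : ℝ) (x₀ : E) :
    reflect k t₀ x₀ = stPull (-1) (-1) t₀ x₀ (curry k) := by
  funext s y
  simp only [reflect_apply, stPull_apply, curry_apply, neg_one_mul, neg_one_smul, sub_eq_add_neg]

/-- **Reflected translates of kernels are space–time test functions in the interior**: if `k`
is smooth and vanishes outside `closedBall 0 r`, and `closedBall (t₀, x₀) r ⊆ Q`, then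
`reflect k t₀ x₀ ∈ C_c^∞(Q)` (Evans, *PDE*, App. C.4). [folklore] -/
theorem isSpaceTimeTestOn_reflect [FiniteDimensional ℝ E] {k : ℝ × E → ℝ} (hk : ContDiff ℝ ∞ k)
    {r : ℝ}
    (hkr : ∀ w, w ∉ closedBall (0 : ℝ × E) r → k w = 0) {Q : Opens (ℝ × E)} {t₀ : ℝ} {x₀ : E}
    (hQ : closedBall ((t₀, x₀) : ℝ × E) r ⊆ Q) : IsSpaceTimeTestOn Q (reflect k t₀ x₀) := by
  change FunctionSpaces.IsTestFunctionOn Q (uncurry (reflect k t₀ x₀))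
  rw [uncurry_reflect]
  have hsupp : support (fun w => k ((t₀, x₀) - w)) ⊆ closedBall ((t₀, x₀) : ℝ × E) r := by
    intro w hw
    by_contra h
    refine hw (hkr _ fun h' => h ?_)
    rw [mem_closedBall, dist_comm, dist_eq_norm]
    simpa using h'
  refine ⟨hk.comp (contDiff_const.sub contDiff_id), ?_, ?_⟩
  · exact HasCompactSupport.intro (isCompact_closedBall _ _) fun w hw => by
      by_contra h; exact hw (hsupp h)
  · exact (closure_minimal hsupp isClosed_closedBall).trans hQ

/-- Vector-valued version: `(s, y) ↦ k(t₀ - s, x₀ - y) • c` is a space–time test field in the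
interior. [folklore] -/
theorem isSpaceTimeTestOn_reflect_smul [FiniteDimensional ℝ E] {k : ℝ × E → ℝ}
    (hk : ContDiff ℝ ∞ k) {r : ℝ} (hkr : ∀ w, w ∉ closedBall (0 : ℝ × E) r → k w = 0)
    {Q : Opens (ℝ × E)} {t₀ : ℝ} {x₀ : E} (hQ : closedBall ((t₀, x₀) : ℝ × E) r ⊆ Q) (c : F') :
    IsSpaceTimeTestOn Q (fun s y => reflect k t₀ x₀ s y • c) := by
  have h := isSpaceTimeTestOn_reflect hk hkr hQ
  have hs : support (uncurry fun s y => reflect k t₀ x₀ s y • c) ⊆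
      support (uncurry (reflect k t₀ x₀)) := fun w hw => by
    contrapose! hw
    simp only [mem_support, not_not] at hw ⊢
    change reflect k t₀ x₀ w.1 w.2 • c = 0
    rw [show reflect k t₀ x₀ w.1 w.2 = 0 from hw, zero_smul]
  refine ⟨?_, h.hasCompactSupport.mono hs, (closure_mono hs).trans h.tsupport_subset⟩
  exact h.contDiff.smul contDiff_const

/-- Time derivative of the reflected translate: `∂ₛ k(t₀ - s, x₀ - y) = -Dk(t₀ - s, x₀ - y)(1, 0)`. [folklore] -/
theorem timeDeriv_reflect {k : ℝ × E → ℝ} (hk : Differentiable ℝ k) (t₀ : ℝ) (x₀ : E) (s : ℝ)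
    (y : E) : timeDeriv (reflect k t₀ x₀) s y = -fderiv ℝ k (t₀ - s, x₀ - y) (1, 0) := by
  rw [timeDeriv_apply]
  have h1 : HasDerivAt (fun r : ℝ => (t₀ - r, x₀ - y)) ((-1 : ℝ), (0 : E)) s := by
    have := ((hasDerivAt_id s).const_sub t₀).prodMk (hasDerivAt_const s (x₀ - y))
    simpa using this
  have h2 : HasDerivAt (fun r => k (t₀ - r, x₀ - y))
      (fderiv ℝ k (t₀ - s, x₀ - y) ((-1 : ℝ), (0 : E))) s :=
    (hk (t₀ - s, x₀ - y)).hasFDerivAt.comp_hasDerivAt s h1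
  simp only [reflect_apply]
  rw [h2.deriv]
  have : ((-1 : ℝ), (0 : E)) = -((1 : ℝ), (0 : E)) := by simp
  rw [this, map_neg]

/-- Spatial derivative of the reflected translate:
`D_y k(t₀ - s, x₀ - ·)(y) v = -Dk(t₀ - s, x₀ - y)(0, v)`. [folklore] -/
theorem fderiv_reflect_apply {k : ℝ × E → ℝ} (hk : Differentiable ℝ k) (t₀ : ℝ) (x₀ : E)
    (s : ℝ) (y v : E) :
    fderiv ℝ (reflect k t₀ x₀ s) y v = -fderiv ℝ k (t₀ - s, x₀ - y) (0, v) := by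
  have h1 : HasFDerivAt (fun y' : E => ((t₀ - s : ℝ), x₀ - y'))
      ((0 : E →L[ℝ] ℝ).prod (-ContinuousLinearMap.id ℝ E)) y := by
    have := (hasFDerivAt_const (𝕜 := ℝ) (t₀ - s) y).prodMk
      ((hasFDerivAt_id (𝕜 := ℝ) y).const_sub x₀)
    simpa using this
  have h2 : HasFDerivAt (reflect k t₀ x₀ s)
      ((fderiv ℝ k (t₀ - s, x₀ - y)).comp ((0 : E →L[ℝ] ℝ).prod (-ContinuousLinearMap.id ℝ E)))
      y := (hk (t₀ - s, x₀ - y)).hasFDerivAt.comp y h1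
  rw [h2.fderiv, ContinuousLinearMap.comp_apply, ContinuousLinearMap.prod_apply]
  have : ((0 : E →L[ℝ] ℝ) v, (-ContinuousLinearMap.id ℝ E) v) = -((0 : ℝ), v) := by simp
  rw [this, map_neg]

variable [FiniteDimensional ℝ E]

/-- The **spatial Laplacian** of a space–time kernel, `Δ_y k (t, x) = Δ(k(t, ·))(x)`. [folklore] -/
def spaceLaplacian (k : ℝ × E → ℝ) (w : ℝ × E) : ℝ :=
  (Δ (fun y => k (w.1, y))) w.2

/-- The spatial Laplacian as a sum of second space–time directional derivatives. [folklore] -/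
theorem spaceLaplacian_eq_sum {ι : Type*} [Fintype ι] (b : OrthonormalBasis ι ℝ E) {k : ℝ × E → ℝ}
    (hk : ContDiff ℝ 2 k) (w : ℝ × E) :
    spaceLaplacian k w = ∑ i, fderiv ℝ (fun w' => fderiv ℝ k w' (0, b i)) w (0, b i) := by
  rw [spaceLaplacian, laplacian_slice_eq_sum b hk]

/-- Laplacian of the reflected translate: `Δ_y k(t₀ - s, x₀ - ·)(y) = (Δ_y k)(t₀ - s, x₀ - y)`. [folklore] -/
theorem laplacian_reflect {k : ℝ × E → ℝ} (hk : ContDiff ℝ 2 k) (t₀ : ℝ) (x₀ : E) (s : ℝ)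
    (y : E) : (Δ (reflect k t₀ x₀ s)) y = spaceLaplacian k (t₀ - s, x₀ - y) := by
  have h2 : ContDiff ℝ 2 (curry k (t₀ + -1 * s)) := contDiff_slice hk _
  rw [reflect_eq_stPull, laplacian_stPull _ _ _ _ _ _ _ h2]
  simp only [neg_mul, one_mul, neg_smul, one_smul, even_two, Even.neg_pow, one_pow, spaceLaplacian,
    sub_eq_add_neg]
  rfl

end Reflect

/-! ### Smoothness and support of the differentiated kernels -/

section KernelSupport

variable {E : Type*} [NormedAddCommGroup E] [InnerProductSpace ℝ E] [FiniteDimensional ℝ E]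

omit [InnerProductSpace ℝ E] [FiniteDimensional ℝ E] in
/-- A function vanishing outside `closedBall 0 r` has topological support in that ball. [folklore] -/
theorem tsupport_subset_closedBall_of {X : Type*} [TopologicalSpace X] {k : ℝ × E → X} [Zero X]
    {r : ℝ} (hkr : ∀ w, w ∉ closedBall (0 : ℝ × E) r → k w = 0) :
    tsupport k ⊆ closedBall (0 : ℝ × E) r :=
  closure_minimal (fun w hw => by by_contra h; exact hw (hkr w h)) isClosed_closedBall

/-- A function vanishing outside a closed ball has compact support. [folklore] -/
theorem hasCompactSupport_of_closedBall {X : Type*} [TopologicalSpace X] [Zero X] {k : ℝ × E → X}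
    {r : ℝ} (hkr : ∀ w, w ∉ closedBall (0 : ℝ × E) r → k w = 0) : HasCompactSupport k :=
  HasCompactSupport.intro (isCompact_closedBall _ _) hkr

omit [FiniteDimensional ℝ E] in
/-- The directional derivatives of a kernel vanishing outside `closedBall 0 r` vanish outside
that ball. [folklore] -/
theorem fderiv_apply_eq_zero_of_closedBall {k : ℝ × E → ℝ} {r : ℝ}
    (hkr : ∀ w, w ∉ closedBall (0 : ℝ × E) r → k w = 0) (v : ℝ × E) :
    ∀ w, w ∉ closedBall (0 : ℝ × E) r → fderiv ℝ k w v = 0 := fun w hw => by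
  rw [fderiv_of_notMem_tsupport ℝ (fun h => hw (tsupport_subset_closedBall_of hkr h))]
  rfl

/-- The spatial Laplacian of a `C^∞` kernel, as a function, is the sum of second space–time
directional derivatives. [folklore] -/
theorem spaceLaplacian_eq_sum_fun {k : ℝ × E → ℝ} (hk : ContDiff ℝ ∞ k) :
    spaceLaplacian k = fun w => ∑ i, fderiv ℝ
      (fun w' => fderiv ℝ k w' (0, stdOrthonormalBasis ℝ E i)) w (0, stdOrthonormalBasis ℝ E i) :=
  funext fun w => spaceLaplacian_eq_sum _ (hk.of_le two_le_infty) w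

/-- The spatial Laplacian of a `C^∞` kernel is `C^∞`. [folklore] -/
theorem contDiff_spaceLaplacian {k : ℝ × E → ℝ} (hk : ContDiff ℝ ∞ k) :
    ContDiff ℝ ∞ (spaceLaplacian k) := by
  rw [spaceLaplacian_eq_sum_fun hk]
  exact ContDiff.sum fun i _ =>
    contDiff_fderiv_apply_const (contDiff_fderiv_apply_const hk _) _

/-- The spatial Laplacian of a `C^∞` kernel vanishing outside `closedBall 0 r` vanishes outside
that ball. [folklore] -/
theorem spaceLaplacian_eq_zero_of_closedBall {k : ℝ × E → ℝ} (hk : ContDiff ℝ ∞ k) {r : ℝ}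
    (hkr : ∀ w, w ∉ closedBall (0 : ℝ × E) r → k w = 0) :
    ∀ w, w ∉ closedBall (0 : ℝ × E) r → spaceLaplacian k w = 0 := fun w hw => by
  rw [spaceLaplacian_eq_sum_fun hk]
  exact Finset.sum_eq_zero fun i _ =>
    fderiv_apply_eq_zero_of_closedBall (fderiv_apply_eq_zero_of_closedBall hkr _) _ w hw

/-- A continuous function vanishing outside a closed ball is bounded. [folklore] -/
theorem exists_bound_of_closedBall {X : Type*} [NormedAddCommGroup X] {k : ℝ × E → X}
    (hk : Continuous k) {r : ℝ} (hkr : ∀ w, w ∉ closedBall (0 : ℝ × E) r → k w = 0) :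
    ∃ C, ∀ w, ‖k w‖ ≤ C :=
  hk.bounded_above_of_compact_support (hasCompactSupport_of_closedBall hkr)

end KernelSupport

/-! ### Space–time mollification and its derivatives -/

section Mollify

variable {E : Type*} [NormedAddCommGroup E] [InnerProductSpace ℝ E] [FiniteDimensional ℝ E]
  [MeasurableSpace E] [BorelSpace E]
variable {F : Type*} [NormedAddCommGroup F] [NormedSpace ℝ F]

/-- Lebesgue measure on space–time `ℝ × E` is an additive Haar measure (product of Haar
measures; Mathlib's `Measure.prod.instIsAddHaarMeasure`, which instance search does not find
through `volume`). [folklore] -/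
local instance instIsAddHaarMeasureVolumeSpaceTime : (volume : Measure (ℝ × E)).IsAddHaarMeasure :=
  Measure.prod.instIsAddHaarMeasure _ _

/-- **Space–time mollification** `(k ⋆ g)(t, x) = ∫ k((t, x) - w) g(w) dw` of `g : ℝ × E → F`
by a scalar kernel `k` on `ℝ × E`, as a curried field (time first); Mathlib's convolution
`k ⋆[lsmul ℝ ℝ] g` for the product Lebesgue measure (Evans, *PDE*, App. C.4; the space–time
regularisation of Caffarelli–Kohn–Nirenberg 1982, §2 and Escauriaza–Seregin–Šverák 2003, §3). [folklore] -/
def stMollify (k : ℝ × E → ℝ) (g : ℝ × E → F) : ℝ → E → F :=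
  curry (k ⋆[lsmul ℝ ℝ, volume] g)

variable {k : ℝ × E → ℝ} {g : ℝ × E → F}

/-- `uncurry (stMollify k g) = k ⋆ g`. [folklore] -/
@[simp]
theorem uncurry_stMollify (k : ℝ × E → ℝ) (g : ℝ × E → F) :
    uncurry (stMollify k g) = k ⋆[lsmul ℝ ℝ, volume] g :=
  rfl

/-- `stMollify k g t x = (k ⋆ g)(t, x)`. [folklore] -/
theorem stMollify_apply (k : ℝ × E → ℝ) (g : ℝ × E → F) (t : ℝ) (x : E) :
    stMollify k g t x = (k ⋆[lsmul ℝ ℝ, volume] g) (t, x) :=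
  rfl

/-- The symmetric integral form `stMollify k g t x = ∫ k((t, x) - w) • g w dw`. [folklore] -/
theorem stMollify_eq_integral (k : ℝ × E → ℝ) (g : ℝ × E → F) (t : ℝ) (x : E) :
    stMollify k g t x = ∫ w, k ((t, x) - w) • g w :=
  convolution_lsmul_apply_eq _

/-- The mollification by a `C^∞` compactly supported kernel is jointly `C^∞`. [folklore] -/
theorem contDiff_uncurry_stMollify (hk : ContDiff ℝ ∞ k) (hkc : HasCompactSupport k)
    (hg : LocallyIntegrable g volume) : ContDiff ℝ ∞ (uncurry (stMollify k g)) :=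
  contDiff_convolution_lsmul hk hkc hg

/-- The slices of the mollification are `C^∞`. [folklore] -/
theorem contDiff_stMollify_slice (hk : ContDiff ℝ ∞ k) (hkc : HasCompactSupport k)
    (hg : LocallyIntegrable g volume) (t : ℝ) : ContDiff ℝ ∞ (stMollify k g t) :=
  contDiff_slice (contDiff_uncurry_stMollify hk hkc hg) t

/-- **Time derivative of the mollification**: `∂ₜ(k ⋆ g) = (∂_{(1,0)} k) ⋆ g`. [folklore] -/
theorem timeDeriv_stMollify (hk : ContDiff ℝ ∞ k) (hkc : HasCompactSupport k)
    (hg : LocallyIntegrable g volume) (t : ℝ) (x : E) :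
    timeDeriv (stMollify k g) t x = stMollify (fun w => fderiv ℝ k w (1, 0)) g t x := by
  have hd : DifferentiableAt ℝ (k ⋆[lsmul ℝ ℝ, volume] g) (t, x) :=
    (contDiff_convolution_lsmul hk hkc hg).differentiable (by simp) _
  rw [stMollify, timeDeriv_curry_eq_fderiv hd,
    fderiv_convolution_lsmul_haar_apply (hk.of_le one_le_infty) hkc hg]
  rfl

/-- **Spatial derivative of the mollification**: `D_x(k ⋆ g)(t, ·)(x) v = ((∂_{(0,v)} k) ⋆ g)(t, x)`. [folklore] -/
theorem fderiv_stMollify_apply (hk : ContDiff ℝ ∞ k) (hkc : HasCompactSupport k)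
    (hg : LocallyIntegrable g volume) (t : ℝ) (x v : E) :
    fderiv ℝ (stMollify k g t) x v = stMollify (fun w => fderiv ℝ k w (0, v)) g t x := by
  have hd : DifferentiableAt ℝ (k ⋆[lsmul ℝ ℝ, volume] g) (t, x) :=
    (contDiff_convolution_lsmul hk hkc hg).differentiable (by simp) _
  change fderiv ℝ (fun y => (k ⋆[lsmul ℝ ℝ, volume] g) (t, y)) x v = _
  rw [fderiv_slice_apply hd, fderiv_convolution_lsmul_haar_apply (hk.of_le one_le_infty) hkc hg]
  rfl

/-- Linearity of the scalar convolution in the kernel over finite sums. [folklore] -/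
theorem finset_sum_convolution_lsmul {ι : Type*} (s : Finset ι) (k : ι → ℝ × E → ℝ)
    (g : ℝ × E → F) (z : ℝ × E) (h : ∀ i ∈ s, ConvolutionExistsAt (k i) g z (lsmul ℝ ℝ) volume) :
    ((fun w => ∑ i ∈ s, k i w) ⋆[lsmul ℝ ℝ, volume] g) z =
      ∑ i ∈ s, (k i ⋆[lsmul ℝ ℝ, volume] g) z := by
  simp only [convolution_def, lsmul_apply, Finset.sum_smul]
  exact integral_finsetSum s fun i hi => (h i hi).integrable

/-- **Laplacian of the mollification**: `Δ_x (k ⋆ g)(t, ·)(x) = ((Δ_y k) ⋆ g)(t, x)` with the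
spatial Laplacian `spaceLaplacian k` of the kernel. [folklore] -/
theorem laplacian_stMollify {F' : Type*} [NormedAddCommGroup F'] [InnerProductSpace ℝ F']
    {g : ℝ × E → F'} (hk : ContDiff ℝ ∞ k) (hkc : HasCompactSupport k)
    (hg : LocallyIntegrable g volume) (t : ℝ) (x : E) :
    (Δ (stMollify k g t)) x = stMollify (spaceLaplacian k) g t x := by
  set b := stdOrthonormalBasis ℝ E
  have hH : ContDiff ℝ 2 (k ⋆[lsmul ℝ ℝ, volume] g) :=
    (contDiff_convolution_lsmul hk hkc hg).of_le two_le_infty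
  have hk1 : ContDiff ℝ 1 k := hk.of_le one_le_infty
  change (Δ (fun y => (k ⋆[lsmul ℝ ℝ, volume] g) (t, y))) x = _
  rw [laplacian_slice_eq_sum b hH, stMollify_apply, spaceLaplacian_eq_sum_fun hk,
    finset_sum_convolution_lsmul]
  · refine Finset.sum_congr rfl fun i _ => ?_
    have h1 : (fun w => fderiv ℝ (k ⋆[lsmul ℝ ℝ, volume] g) w (0, b i)) =
        (fun w => fderiv ℝ k w (0, b i)) ⋆[lsmul ℝ ℝ, volume] g := by
      funext w
      exact fderiv_convolution_lsmul_haar_apply hk1 hkc hg w (0, b i)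
    rw [h1]
    exact fderiv_convolution_lsmul_haar_apply
      ((contDiff_fderiv_apply_const hk _).of_le one_le_infty)
      (hasCompactSupport_fderiv_apply_const hkc _) hg (t, x) (0, b i)
  · intro i _
    refine HasCompactSupport.convolutionExists_left _ ?_ ?_ hg _
    · exact hasCompactSupport_fderiv_apply_const (hasCompactSupport_fderiv_apply_const hkc _) _
    · exact (contDiff_fderiv_apply_const (contDiff_fderiv_apply_const hk _) _).continuous

/-- **Divergence of the mollification** of a vector field `g : ℝ × E → E`:
`div_x (k ⋆ g)(t, ·)(x) = ∫ Dk((t, x) - w)(0, g(w)) dw`. [folklore] -/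
theorem divergence_stMollify {g : ℝ × E → E} (hk : ContDiff ℝ ∞ k) (hkc : HasCompactSupport k)
    (hg : LocallyIntegrable g volume) (t : ℝ) (x : E) :
    VectorCalculus.divergence (stMollify k g t) x = ∫ w, fderiv ℝ k ((t, x) - w) (0, g w) := by
  set b := stdOrthonormalBasis ℝ E
  have hki : ∀ v, ContDiff ℝ ∞ fun w => fderiv ℝ k w (0, v) := fun v =>
    contDiff_fderiv_apply_const hk _
  have hkci : ∀ v, HasCompactSupport fun w => fderiv ℝ k w (0, v) := fun v =>
    hasCompactSupport_fderiv_apply_const hkc _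
  have hexg : ∀ v, ConvolutionExistsAt (fun w => fderiv ℝ k w (0, v)) g (t, x) (lsmul ℝ ℝ)
      volume := fun v => (hkci v).convolutionExists_left _ (hki v).continuous hg _
  rw [divergence_eq_sum_inner_fderiv b]
  have h1 : ∀ i, ⟪b i, fderiv ℝ (stMollify k g t) x (b i)⟫ =
      ∫ w, fderiv ℝ k ((t, x) - w) (0, b i) * ⟪g w, b i⟫ := fun i => by
    rw [real_inner_comm, fderiv_stMollify_apply hk hkc hg, stMollify_apply,
      inner_convolution_lsmul_apply (hexg (b i)) (b i), convolution_lsmul_apply_eq]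
    rfl
  have h2 : ∀ w, (∑ i, fderiv ℝ k ((t, x) - w) (0, b i) * ⟪g w, b i⟫) =
      fderiv ℝ k ((t, x) - w) (0, g w) := fun w => by
    have h3 : ((0 : ℝ), ∑ i, ⟪b i, g w⟫ • b i) = ∑ i, ⟪b i, g w⟫ • ((0 : ℝ), b i) := by
      simp [Prod.ext_iff, Prod.fst_sum, Prod.snd_sum]
    conv_rhs => rw [← b.sum_repr' (g w), h3, map_sum]
    refine Finset.sum_congr rfl fun i _ => ?_
    rw [map_smul, smul_eq_mul, mul_comm, real_inner_comm (b i)]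
  have hint : ∀ i ∈ Finset.univ, Integrable (fun w => fderiv ℝ k ((t, x) - w) (0, b i) * ⟪g w, b i⟫)
      (volume : Measure (ℝ × E)) := fun i _ => by
    have := (hexg (b i)).integrable_swap.inner_const (𝕜 := ℝ) (b i)
    simpa only [lsmul_apply, real_inner_smul_left] using this
  simp_rw [h1]
  rw [← integral_finsetSum _ hint]
  exact integral_congr_ae (Eventually.of_forall h2)

end Mollify

/-! ### Zero extensions and localised kernels -/

section ZeroExt

variable {E : Type*} [NormedAddCommGroup E] [InnerProductSpace ℝ E] [FiniteDimensional ℝ E]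
  [MeasurableSpace E] [BorelSpace E]
variable {F : Type*} [NormedAddCommGroup F] [NormedSpace ℝ F]

/-- The **zero extension** `𝟙_Q f` to all of space–time of a curried field `f` given on an open
set `Q ⊆ ℝ × E` (the function that is mollified in Caffarelli–Kohn–Nirenberg 1982, §2 and
Escauriaza–Seregin–Šverák 2003, §3). [folklore] -/
def zeroExt (Q : Opens (ℝ × E)) (f : ℝ → E → F) : ℝ × E → F :=
  (Q : Set (ℝ × E)).indicator (uncurry f)

variable {Q : Opens (ℝ × E)}

omit [InnerProductSpace ℝ E] [FiniteDimensional ℝ E] [MeasurableSpace E] [BorelSpace E]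
  [NormedSpace ℝ F] in
/-- On `Q` the zero extension is the field. [folklore] -/
theorem zeroExt_of_mem (f : ℝ → E → F) {z : ℝ × E} (hz : z ∈ (Q : Set (ℝ × E))) :
    zeroExt Q f z = f z.1 z.2 :=
  indicator_of_mem hz _

omit [InnerProductSpace ℝ E] [FiniteDimensional ℝ E] [MeasurableSpace E] [BorelSpace E]
  [NormedSpace ℝ F] in
/-- Off `Q` the zero extension vanishes. [folklore] -/
theorem zeroExt_of_not_mem (f : ℝ → E → F) {z : ℝ × E} (hz : z ∉ (Q : Set (ℝ × E))) :
    zeroExt Q f z = 0 :=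
  indicator_of_notMem hz _

omit [NormedSpace ℝ F] in
/-- The zero extension of a field integrable on `Q` is integrable on space–time. [folklore] -/
theorem integrable_zeroExt {f : ℝ → E → F}
    (hf : IntegrableOn (uncurry f) (Q : Set (ℝ × E)) volume) :
    Integrable (zeroExt Q f) (volume : Measure (ℝ × E)) :=
  hf.integrable_indicator Q.isOpen.measurableSet

omit [NormedSpace ℝ F] in
/-- The zero extension of a field integrable on `Q` is locally integrable on space–time. [folklore] -/
theorem locallyIntegrable_zeroExt {f : ℝ → E → F}
    (hf : IntegrableOn (uncurry f) (Q : Set (ℝ × E)) volume) :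
    LocallyIntegrable (zeroExt Q f) (volume : Measure (ℝ × E)) :=
  (integrable_zeroExt hf).locallyIntegrable

/-- Set integrals over `Q` against a scalar weight are whole-space integrals of the zero
extension. [folklore] -/
theorem setIntegral_smul_eq_integral_zeroExt (c : ℝ × E → ℝ) (f : ℝ → E → F) :
    ∫ z in (Q : Set (ℝ × E)), c z • f z.1 z.2 = ∫ z, c z • zeroExt Q f z := by
  rw [← integral_indicator Q.isOpen.measurableSet]
  congr 1
  funext z
  rw [zeroExt, ← indicator_smul_apply]
  rfl

omit [FiniteDimensional ℝ E] [MeasurableSpace E] [BorelSpace E] in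
/-- Inner products with a constant vector commute with the zero extension. [folklore] -/
theorem inner_zeroExt_left (f : ℝ → E → E) (e : E) (z : ℝ × E) :
    ⟪zeroExt Q f z, e⟫ = zeroExt Q (fun t x => ⟪f t x, e⟫) z := by
  by_cases hz : z ∈ (Q : Set (ℝ × E))
  · rw [zeroExt_of_mem f hz, zeroExt_of_mem _ hz]
  · rw [zeroExt_of_not_mem f hz, zeroExt_of_not_mem _ hz, inner_zero_left]

omit [InnerProductSpace ℝ E] [FiniteDimensional ℝ E] [MeasurableSpace E] [BorelSpace E] in
/-- A kernel vanishing outside `closedBall 0 r`, reflected about a centre `z₀` with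
`closedBall z₀ r ⊆ Q`, vanishes off `Q`. [folklore] -/
theorem kernel_sub_eq_zero_of_not_mem {k : ℝ × E → ℝ} {r : ℝ}
    (hkr : ∀ w, w ∉ closedBall (0 : ℝ × E) r → k w = 0) {z₀ : ℝ × E}
    (hQ : closedBall z₀ r ⊆ Q) {z : ℝ × E} (hz : z ∉ (Q : Set (ℝ × E))) : k (z₀ - z) = 0 := by
  refine hkr _ fun h => hz (hQ ?_)
  rw [mem_closedBall, dist_comm, dist_eq_norm]
  simpa using h

/-- Integrability of `c • 𝟙_Q f` for a bounded continuous weight `c`. [folklore] -/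
theorem integrable_smul_zeroExt {c : ℝ × E → ℝ} (hc : Continuous c) {C : ℝ} (hC : ∀ w, ‖c w‖ ≤ C)
    {f : ℝ → E → F} (hf : IntegrableOn (uncurry f) (Q : Set (ℝ × E)) volume) :
    Integrable (fun z => c z • zeroExt Q f z) (volume : Measure (ℝ × E)) :=
  (integrable_zeroExt hf).bdd_smul C hc.aestronglyMeasurable (Eventually.of_forall hC)

end ZeroExt

/-! ### Mollified distributional Navier–Stokes solutions satisfy the equations pointwise -/

section MollifiedNS

variable {E : Type*} [NormedAddCommGroup E] [InnerProductSpace ℝ E] [FiniteDimensional ℝ E]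
  [MeasurableSpace E] [BorelSpace E]

/-- Lebesgue measure on space–time `ℝ × E` is an additive Haar measure. [folklore] -/
local instance instIsAddHaarMeasureVolumeSpaceTime' :
    (volume : Measure (ℝ × E)).IsAddHaarMeasure :=
  Measure.prod.instIsAddHaarMeasure _ _

variable {Q : Opens (ℝ × E)} {ν : ℝ} {u : ℝ → E → E} {p : ℝ → E → ℝ}
variable {k : ℝ × E → ℝ} {r t₀ : ℝ} {x₀ : E}

/-- Evaluation of `x ↦ Dk(z₀ - x)(0, v x)` is a.e.-strongly measurable for a `C¹` kernel and an
a.e.-strongly measurable field `v`. [folklore] -/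
theorem aestronglyMeasurable_fderiv_sub_apply {μ : Measure (ℝ × E)} (hk : ContDiff ℝ 1 k)
    (z₀ : ℝ × E) {v : ℝ × E → E} (hv : AEStronglyMeasurable v μ) :
    AEStronglyMeasurable (fun z => fderiv ℝ k (z₀ - z) ((0 : ℝ), v z)) μ := by
  have h1 : Continuous fun z : ℝ × E => fderiv ℝ k (z₀ - z) :=
    (hk.continuous_fderiv one_ne_zero).comp (continuous_const.sub continuous_id)
  have h2 : AEStronglyMeasurable (fun z => ((0 : ℝ), v z)) μ :=
    aestronglyMeasurable_const.prodMk hv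
  exact isBoundedBilinearMap_apply.continuous.comp_aestronglyMeasurable
    (h1.aestronglyMeasurable.prodMk h2)

/-- **The mollified momentum equation.** Let `(u, p)` be a distributional solution of the
unforced Navier–Stokes system on an open set `Q ⊆ ℝ × E` (accepted
`Fluid.IsDistributionalNSSolutionOn`) with `u`, `|u|²` and `p` integrable on `Q`; let `k` be a
`C^∞` kernel vanishing outside `closedBall 0 r` and let `closedBall (t₀, x₀) r ⊆ Q`. Then the
space–time mollifications `V = k ⋆ 𝟙_Q u`, `N_e = k ⋆ 𝟙_Q (⟪u, e⟫ u)`, `P = k ⋆ 𝟙_Q p` satisfy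
the `e`-component of the momentum equation **pointwise** at `(t₀, x₀)`:
`⟪∂ₜV, e⟫ + div N_e - ν ⟪ΔV, e⟫ + ∂ₑP = 0`. This is the distributional identity tested with
`ψ = k((t₀, x₀) - ·) e` (Caffarelli–Kohn–Nirenberg 1982, §2, "the equations hold for the
mollified functions"; Escauriaza–Seregin–Šverák 2003, §3, proof of Thm. 1.4, "usual
mollification"). [cite: CaffarelliKohnNirenberg1982, §2] -/
theorem IsDistributionalNSSolutionOn.mollified_momentum
    (h : IsDistributionalNSSolutionOn Q ν 0 u p)
    (hu : IntegrableOn (uncurry u) (Q : Set (ℝ × E)) volume)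
    (hu2 : IntegrableOn (fun z => ‖uncurry u z‖ ^ 2) (Q : Set (ℝ × E)) volume)
    (hp : IntegrableOn (uncurry p) (Q : Set (ℝ × E)) volume)
    (hk : ContDiff ℝ ∞ k) (hkr : ∀ w, w ∉ closedBall (0 : ℝ × E) r → k w = 0)
    (hQ : closedBall ((t₀, x₀) : ℝ × E) r ⊆ Q) (e : E) :
    ⟪timeDeriv (stMollify k (zeroExt Q u)) t₀ x₀, e⟫ +
      VectorCalculus.divergence (stMollify k (zeroExt Q fun t x => ⟪u t x, e⟫ • u t x) t₀) x₀ -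
      ν * ⟪(Δ (stMollify k (zeroExt Q u) t₀)) x₀, e⟫ +
      fderiv ℝ (stMollify k (zeroExt Q p) t₀) x₀ e = 0 := by
  -- the kernels
  set k₁ : ℝ × E → ℝ := fun w => fderiv ℝ k w (1, 0) with hk₁
  set kₑ : ℝ × E → ℝ := fun w => fderiv ℝ k w (0, e) with hkₑ
  have hkc : HasCompactSupport k := hasCompactSupport_of_closedBall hkr
  have hk1 : ContDiff ℝ 1 k := hk.of_le one_le_infty
  have hkd : Differentiable ℝ k := hk1.differentiable one_ne_zero
  have hk₁c : Continuous k₁ := (contDiff_fderiv_apply_const hk _).continuous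
  have hkₑc : Continuous kₑ := (contDiff_fderiv_apply_const hk _).continuous
  have hkΔc : Continuous (spaceLaplacian k) := (contDiff_spaceLaplacian hk).continuous
  have hk₁r := fderiv_apply_eq_zero_of_closedBall hkr ((1 : ℝ), (0 : E))
  have hkₑr := fderiv_apply_eq_zero_of_closedBall hkr ((0 : ℝ), e)
  have hkΔr := spaceLaplacian_eq_zero_of_closedBall hk hkr
  obtain ⟨C₁, hC₁⟩ := exists_bound_of_closedBall hk₁c hk₁r
  obtain ⟨Cₑ, hCₑ⟩ := exists_bound_of_closedBall hkₑc hkₑr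
  obtain ⟨CΔ, hCΔ⟩ := exists_bound_of_closedBall hkΔc hkΔr
  obtain ⟨CD, hCD⟩ := (hk.continuous_fderiv (by simp)).bounded_above_of_compact_support
    (hkc.fderiv ℝ)
  -- zero extensions
  have hQm : MeasurableSet (Q : Set (ℝ × E)) := Q.isOpen.measurableSet
  have huN : IntegrableOn (uncurry fun t x => ⟪u t x, e⟫ • u t x) (Q : Set (ℝ × E)) volume := by
    refine Integrable.mono' (hu2.mul_const ‖e‖) ?_ (Eventually.of_forall fun z => ?_)
    · exact (hu.aestronglyMeasurable.inner aestronglyMeasurable_const).smul hu.aestronglyMeasurable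
    · change ‖⟪u z.1 z.2, e⟫ • u z.1 z.2‖ ≤ ‖uncurry u z‖ ^ 2 * ‖e‖
      rw [norm_smul]
      calc ‖⟪u z.1 z.2, e⟫‖ * ‖u z.1 z.2‖ ≤ (‖u z.1 z.2‖ * ‖e‖) * ‖u z.1 z.2‖ := by
            gcongr; exact norm_inner_le_norm _ _
        _ = ‖uncurry u z‖ ^ 2 * ‖e‖ := by rw [show uncurry u z = u z.1 z.2 from rfl]; ring
  have huE : LocallyIntegrable (zeroExt Q u) volume := locallyIntegrable_zeroExt hu
  have hpE : LocallyIntegrable (zeroExt Q p) volume := locallyIntegrable_zeroExt hp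
  have hNE : LocallyIntegrable (zeroExt Q fun t x => ⟪u t x, e⟫ • u t x) volume :=
    locallyIntegrable_zeroExt huN
  -- the test field `ψ = k(z₀ - ·) e`
  set θ : ℝ → E → ℝ := reflect k t₀ x₀ with hθ_def
  have hθ : IsSpaceTimeTestOn Q θ := isSpaceTimeTestOn_reflect hk hkr hQ
  set ψ : ℝ → E → E := fun s y => θ s y • e with hψ_def
  have hψ : IsSpaceTimeTestOn Q ψ := isSpaceTimeTestOn_reflect_smul hk hkr hQ e
  have key := h.2.2.2.2 ψ hψ
  -- the four integrands
  set A : ℝ × E → ℝ := fun z => k₁ ((t₀, x₀) - z) * ⟪u z.1 z.2, e⟫ with hA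
  set B : ℝ × E → ℝ := fun z => fderiv ℝ k ((t₀, x₀) - z) (0, u z.1 z.2) * ⟪u z.1 z.2, e⟫ with hB
  set Cc : ℝ × E → ℝ := fun z => spaceLaplacian k ((t₀, x₀) - z) * ⟪u z.1 z.2, e⟫ with hCc
  set D : ℝ × E → ℝ := fun z => kₑ ((t₀, x₀) - z) * p z.1 z.2 with hD
  have hpt : ∀ z : ℝ × E, (⟪u z.1 z.2, timeDeriv ψ z.1 z.2⟫ +
      ⟪u z.1 z.2, convect (u z.1) (ψ z.1) z.2⟫ + ν * ⟪u z.1 z.2, (Δ (ψ z.1)) z.2⟫ +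
      p z.1 z.2 * VectorCalculus.divergence (ψ z.1) z.2 + ⟪(0 : ℝ → E → E) z.1 z.2, ψ z.1 z.2⟫) =
      -A z - B z + ν * Cc z - D z := by
    rintro ⟨s, y⟩
    have hθd : DifferentiableAt ℝ (θ s) y :=
      ((IsSpaceTimeTestOn.contDiff_slice hθ s).differentiable (by simp)) y
    have hθt : DifferentiableAt ℝ (fun s => θ s y) s :=
      (IsSpaceTimeTestOn.hasDerivAt_time hθ s y).differentiableAt
    have hθ2 : ContDiff ℝ 2 (θ s) := IsSpaceTimeTestOn.contDiff_slice_two hθ s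
    have e1 : timeDeriv ψ s y = (-k₁ (t₀ - s, x₀ - y)) • e := by
      rw [hψ_def, timeDeriv_smul_const θ e hθt, hθ_def, timeDeriv_reflect hkd]
    have e2 : convect (u s) (ψ s) y = (-fderiv ℝ k (t₀ - s, x₀ - y) (0, u s y)) • e := by
      rw [hψ_def]
      change convect (u s) (fun y => θ s y • e) y = _
      rw [convect_smul_const (u s) e hθd, hθ_def, fderiv_reflect_apply hkd]
    have e3 : (Δ (ψ s)) y = spaceLaplacian k (t₀ - s, x₀ - y) • e := by
      rw [hψ_def]
      change (Δ (fun y => θ s y • e)) y = _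
      rw [laplacian_smul_const hθ2, hθ_def, laplacian_reflect (hk.of_le two_le_infty)]
    have e4 : VectorCalculus.divergence (ψ s) y = -kₑ (t₀ - s, x₀ - y) := by
      rw [hψ_def]
      change VectorCalculus.divergence (fun y => θ s y • e) y = _
      rw [divergence_smul_const e hθd, hθ_def, fderiv_reflect_apply hkd]
    simp only [e1, e2, e3, e4, hA, hB, hCc, hD, real_inner_smul_right, Pi.zero_apply,
      inner_zero_left, add_zero, Prod.mk_sub_mk]
    ring
  -- integrability of the four integrands on `Q`
  have hmu : AEStronglyMeasurable (uncurry u) (volume.restrict (Q : Set (ℝ × E))) :=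
    hu.aestronglyMeasurable
  have hue : Integrable (fun z : ℝ × E => ⟪u z.1 z.2, e⟫) (volume.restrict (Q : Set (ℝ × E))) :=
    hu.inner_const (𝕜 := ℝ) e
  have hcont : ∀ {c : ℝ × E → ℝ}, Continuous c →
      AEStronglyMeasurable (fun z : ℝ × E => c ((t₀, x₀) - z))
        (volume.restrict (Q : Set (ℝ × E))) := fun hc =>
    (hc.comp (continuous_const.sub continuous_id)).aestronglyMeasurable
  have hAi : Integrable A (volume.restrict (Q : Set (ℝ × E))) :=
    hue.bdd_mul (hcont hk₁c) (Eventually.of_forall fun z => hC₁ _)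
  have hCi : Integrable Cc (volume.restrict (Q : Set (ℝ × E))) :=
    hue.bdd_mul (hcont hkΔc) (Eventually.of_forall fun z => hCΔ _)
  have hDi : Integrable D (volume.restrict (Q : Set (ℝ × E))) :=
    hp.bdd_mul (hcont hkₑc) (Eventually.of_forall fun z => hCₑ _)
  have hCD0 : 0 ≤ CD := (norm_nonneg _).trans (hCD 0)
  have hBi : Integrable B (volume.restrict (Q : Set (ℝ × E))) := by
    refine Integrable.mono' ((hu2.const_mul (CD * ‖e‖))) ?_ (Eventually.of_forall fun z => ?_)
    · exact (aestronglyMeasurable_fderiv_sub_apply hk1 _ hmu).mul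
        (hmu.inner aestronglyMeasurable_const)
    · rw [hB, norm_mul]
      have h1 : ‖fderiv ℝ k ((t₀, x₀) - z) (0, u z.1 z.2)‖ ≤ CD * ‖u z.1 z.2‖ := by
        refine (le_opNorm _ _).trans (mul_le_mul (hCD _) ?_ (norm_nonneg _) hCD0)
        simp [Prod.norm_def]
      have h2 : ‖⟪u z.1 z.2, e⟫‖ ≤ ‖u z.1 z.2‖ * ‖e‖ := norm_inner_le_norm _ _
      calc ‖fderiv ℝ k ((t₀, x₀) - z) (0, u z.1 z.2)‖ * ‖⟪u z.1 z.2, e⟫‖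
          ≤ (CD * ‖u z.1 z.2‖) * (‖u z.1 z.2‖ * ‖e‖) :=
            mul_le_mul h1 h2 (norm_nonneg _) (by positivity)
        _ = CD * ‖e‖ * ‖uncurry u z‖ ^ 2 := by rw [show uncurry u z = u z.1 z.2 from rfl]; ring
  -- split the distributional identity
  have hsplit : ∫ z in (Q : Set (ℝ × E)), (-A z - B z + ν * Cc z - D z) =
      -(∫ z in (Q : Set (ℝ × E)), A z) - (∫ z in (Q : Set (ℝ × E)), B z) +
        ν * (∫ z in (Q : Set (ℝ × E)), Cc z) - ∫ z in (Q : Set (ℝ × E)), D z := by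
    have i3 : Integrable (fun z => ν * Cc z) (volume.restrict (Q : Set (ℝ × E))) :=
      hCi.const_mul ν
    have i4 : Integrable (fun z => -A z) (volume.restrict (Q : Set (ℝ × E))) := hAi.neg
    have i2 : Integrable (fun z => -A z - B z) (volume.restrict (Q : Set (ℝ × E))) := i4.sub hBi
    have i1 : Integrable (fun z => -A z - B z + ν * Cc z) (volume.restrict (Q : Set (ℝ × E))) :=
      i2.add i3
    rw [integral_sub i1 hDi, integral_add i2 i3, integral_sub i4 hBi, integral_neg,
      integral_const_mul]
  rw [setIntegral_congr_fun hQm (fun z _ => hpt z), hsplit] at key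
  -- identify the four terms
  have hexu : ∀ {c : ℝ × E → ℝ}, Continuous c → (∀ w, w ∉ closedBall (0 : ℝ × E) r → c w = 0) →
      ConvolutionExistsAt c (zeroExt Q u) (t₀, x₀) (lsmul ℝ ℝ) volume := fun hc hcr =>
    (hasCompactSupport_of_closedBall hcr).convolutionExists_left _ hc huE _
  have iA : ⟪timeDeriv (stMollify k (zeroExt Q u)) t₀ x₀, e⟫ = ∫ z in (Q : Set (ℝ × E)), A z := by
    rw [timeDeriv_stMollify hk hkc huE, stMollify_apply, inner_convolution_lsmul_apply (hexu hk₁c hk₁r),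
      convolution_lsmul_apply_eq]
    simp_rw [inner_zeroExt_left]
    rw [← setIntegral_smul_eq_integral_zeroExt]
    rfl
  have iC : ⟪(Δ (stMollify k (zeroExt Q u) t₀)) x₀, e⟫ = ∫ z in (Q : Set (ℝ × E)), Cc z := by
    rw [laplacian_stMollify hk hkc huE, stMollify_apply, inner_convolution_lsmul_apply (hexu hkΔc hkΔr),
      convolution_lsmul_apply_eq]
    simp_rw [inner_zeroExt_left]
    rw [← setIntegral_smul_eq_integral_zeroExt]
    rfl
  have iD : fderiv ℝ (stMollify k (zeroExt Q p) t₀) x₀ e = ∫ z in (Q : Set (ℝ × E)), D z := by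
    rw [fderiv_stMollify_apply hk hkc hpE, stMollify_eq_integral,
      ← setIntegral_smul_eq_integral_zeroExt]
    rfl
  have iB : VectorCalculus.divergence (stMollify k (zeroExt Q fun t x => ⟪u t x, e⟫ • u t x) t₀) x₀ =
      ∫ z in (Q : Set (ℝ × E)), B z := by
    rw [divergence_stMollify hk hkc hNE, ← integral_indicator hQm]
    refine integral_congr_ae (Eventually.of_forall fun z => ?_)
    dsimp only
    by_cases hz : z ∈ (Q : Set (ℝ × E))
    · rw [indicator_of_mem hz, zeroExt_of_mem _ hz]
      simp only [hB]
      rw [show ((0 : ℝ), ⟪u z.1 z.2, e⟫ • u z.1 z.2) = ⟪u z.1 z.2, e⟫ • ((0 : ℝ), u z.1 z.2) by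
        rw [Prod.smul_mk, smul_zero], map_smul, smul_eq_mul, mul_comm]
    · rw [indicator_of_notMem hz, zeroExt_of_not_mem _ hz, Prod.mk_zero_zero, map_zero]
  rw [iA, iB, iC, iD]
  linarith

/-- **The mollified velocity is divergence free.** Under the hypotheses of
`mollified_momentum` (only integrability of `u` on `Q` is needed), `div_x (k ⋆ 𝟙_Q u) = 0` at
`(t₀, x₀)`: the weak divergence-free condition tested with `θ = k((t₀, x₀) - ·)`
(Caffarelli–Kohn–Nirenberg 1982, §2). [cite: CaffarelliKohnNirenberg1982, §2] -/
theorem IsDistributionalNSSolutionOn.divergence_mollified_eq_zero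
    (h : IsDistributionalNSSolutionOn Q ν 0 u p)
    (hu : IntegrableOn (uncurry u) (Q : Set (ℝ × E)) volume)
    (hk : ContDiff ℝ ∞ k) (hkr : ∀ w, w ∉ closedBall (0 : ℝ × E) r → k w = 0)
    (hQ : closedBall ((t₀, x₀) : ℝ × E) r ⊆ Q) :
    VectorCalculus.divergence (stMollify k (zeroExt Q u) t₀) x₀ = 0 := by
  have hkc : HasCompactSupport k := hasCompactSupport_of_closedBall hkr
  have hkd : Differentiable ℝ k := (hk.of_le one_le_infty).differentiable one_ne_zero
  have hQm : MeasurableSet (Q : Set (ℝ × E)) := Q.isOpen.measurableSet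
  have huE : LocallyIntegrable (zeroExt Q u) volume := locallyIntegrable_zeroExt hu
  have hθ : IsSpaceTimeTestOn Q (reflect k t₀ x₀) := isSpaceTimeTestOn_reflect hk hkr hQ
  have key := h.2.2.2.1 (reflect k t₀ x₀) hθ
  have hpt : ∀ z : ℝ × E, ⟪u z.1 z.2, gradient (reflect k t₀ x₀ z.1) z.2⟫ =
      -fderiv ℝ k ((t₀, x₀) - z) (0, u z.1 z.2) := by
    rintro ⟨s, y⟩
    rw [inner_gradient_right_eq_fderiv, fderiv_reflect_apply hkd, Prod.mk_sub_mk]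
  rw [setIntegral_congr_fun hQm (fun z _ => hpt z), integral_neg, neg_eq_zero,
    ← integral_indicator hQm] at key
  rw [divergence_stMollify hk hkc huE]
  refine Eq.trans (integral_congr_ae (Eventually.of_forall fun z => ?_)) key
  dsimp only
  by_cases hz : z ∈ (Q : Set (ℝ × E))
  · rw [indicator_of_mem hz, zeroExt_of_mem _ hz]
  · rw [indicator_of_notMem hz, zeroExt_of_not_mem _ hz, Prod.mk_zero_zero, map_zero]

/-- **The spatial gradient of the mollified velocity is the mollified weak gradient**: if `u`
has the weak spatial gradient `G` on `Q` (accepted `Fluid.HasWeakSpatialGradientOn`), `u` and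
`G` are integrable on `Q`, `k` vanishes outside `closedBall 0 r` and `closedBall (t₀, x₀) r ⊆ Q`,
then `D_x(k ⋆ 𝟙_Q u)(t₀, ·)(x₀) = (k ⋆ 𝟙_Q G)(t₀, x₀)` (Evans, *PDE*, §5.3.1, Thm. 1:
`D(η_ε ⋆ u) = η_ε ⋆ Du` in `U_ε`). [cite: Evans2010, §5.3.1 Thm. 1] -/
theorem HasWeakSpatialGradientOn.fderiv_mollified {G : ℝ → E → E →L[ℝ] E}
    (hG : HasWeakSpatialGradientOn Q u G)
    (hu : IntegrableOn (uncurry u) (Q : Set (ℝ × E)) volume)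
    (hGi : IntegrableOn (uncurry G) (Q : Set (ℝ × E)) volume)
    (hk : ContDiff ℝ ∞ k) (hkr : ∀ w, w ∉ closedBall (0 : ℝ × E) r → k w = 0)
    (hQ : closedBall ((t₀, x₀) : ℝ × E) r ⊆ Q) :
    fderiv ℝ (stMollify k (zeroExt Q u) t₀) x₀ = stMollify k (zeroExt Q G) t₀ x₀ := by
  have hkc : HasCompactSupport k := hasCompactSupport_of_closedBall hkr
  have hk1 : ContDiff ℝ 1 k := hk.of_le one_le_infty
  have hkd : Differentiable ℝ k := hk1.differentiable one_ne_zero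
  have huE : LocallyIntegrable (zeroExt Q u) volume := locallyIntegrable_zeroExt hu
  have hθ : IsSpaceTimeTestOn Q (reflect k t₀ x₀) := isSpaceTimeTestOn_reflect hk hkr hQ
  obtain ⟨C₀, hC₀⟩ := exists_bound_of_closedBall hk.continuous hkr
  ext v
  refine ext_inner_right ℝ fun w' => ?_
  set kv : ℝ × E → ℝ := fun w => fderiv ℝ k w (0, v) with hkv
  have hkvc : Continuous kv := (contDiff_fderiv_apply_const hk _).continuous
  have hkvr := fderiv_apply_eq_zero_of_closedBall hkr ((0 : ℝ), v)
  obtain ⟨Cv, hCv⟩ := exists_bound_of_closedBall hkvc hkvr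
  -- the weak-gradient identity against the reflected kernel
  have key := hG.integral_fderiv_mul_inner_eq _ hθ v w'
  have e1 : ∀ t x, fderiv ℝ (reflect k t₀ x₀ t) x v * ⟪u t x, w'⟫ =
      -(kv ((t₀, x₀) - (t, x)) * ⟪u t x, w'⟫) := fun t x => by
    rw [fderiv_reflect_apply hkd, Prod.mk_sub_mk, neg_mul]
  simp_rw [e1, integral_neg, reflect_apply, neg_inj] at key
  -- both iterated integrands agree with their zero-extended versions
  have hAe : ∀ z : ℝ × E, kv ((t₀, x₀) - z) * ⟪u z.1 z.2, w'⟫ =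
      kv ((t₀, x₀) - z) * ⟪zeroExt Q u z, w'⟫ := fun z => by
    by_cases hz : z ∈ (Q : Set (ℝ × E))
    · rw [zeroExt_of_mem _ hz]
    · rw [kernel_sub_eq_zero_of_not_mem (k := kv) hkvr hQ hz, zero_mul, zero_mul]
  have hBe : ∀ z : ℝ × E, k ((t₀, x₀) - z) * ⟪G z.1 z.2 v, w'⟫ =
      k ((t₀, x₀) - z) * ⟪zeroExt Q G z v, w'⟫ := fun z => by
    by_cases hz : z ∈ (Q : Set (ℝ × E))
    · rw [zeroExt_of_mem _ hz]
    · rw [kernel_sub_eq_zero_of_not_mem hkr hQ hz, zero_mul, zero_mul]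
  have hAi : Integrable (fun z => kv ((t₀, x₀) - z) * ⟪zeroExt Q u z, w'⟫)
      (volume : Measure (ℝ × E)) := by
    have := (integrable_zeroExt hu).inner_const (𝕜 := ℝ) w'
    exact this.bdd_mul ((hkvc.comp (continuous_const.sub continuous_id)).aestronglyMeasurable)
      (Eventually.of_forall fun z => hCv _)
  have hBi : Integrable (fun z => k ((t₀, x₀) - z) * ⟪zeroExt Q G z v, w'⟫)
      (volume : Measure (ℝ × E)) := by
    have h1 : Integrable (fun z => zeroExt Q G z v) (volume : Measure (ℝ × E)) :=
      (ContinuousLinearMap.apply ℝ E v).integrable_comp (integrable_zeroExt hGi)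
    exact (h1.inner_const (𝕜 := ℝ) w').bdd_mul
      ((hk.continuous.comp (continuous_const.sub continuous_id)).aestronglyMeasurable)
      (Eventually.of_forall fun z => hC₀ _)
  have hL : ∫ t, ∫ x, kv ((t₀, x₀) - (t, x)) * ⟪u t x, w'⟫ =
      ∫ z, kv ((t₀, x₀) - z) * ⟪zeroExt Q u z, w'⟫ := by
    have h1 : (fun t => ∫ x, kv ((t₀, x₀) - (t, x)) * ⟪u t x, w'⟫) =
        fun t => ∫ x, kv ((t₀, x₀) - (t, x)) * ⟪zeroExt Q u (t, x), w'⟫ := by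
      funext t; exact integral_congr_ae (Eventually.of_forall fun x => hAe (t, x))
    rw [h1, Measure.volume_eq_prod,
      ← integral_prod (fun z : ℝ × E => kv ((t₀, x₀) - z) * ⟪zeroExt Q u z, w'⟫)
        (by simpa [Measure.volume_eq_prod] using hAi)]
  have hR : ∫ t, ∫ x, k (t₀ - t, x₀ - x) * ⟪G t x v, w'⟫ =
      ∫ z, k ((t₀, x₀) - z) * ⟪zeroExt Q G z v, w'⟫ := by
    have h1 : (fun t => ∫ x, k (t₀ - t, x₀ - x) * ⟪G t x v, w'⟫) =
        fun t => ∫ x, k ((t₀, x₀) - (t, x)) * ⟪zeroExt Q G (t, x) v, w'⟫ := by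
      funext t
      exact integral_congr_ae (Eventually.of_forall fun x => hBe (t, x))
    rw [h1, Measure.volume_eq_prod,
      ← integral_prod (fun z : ℝ × E => k ((t₀, x₀) - z) * ⟪zeroExt Q G z v, w'⟫)
        (by simpa [Measure.volume_eq_prod] using hBi)]
  rw [hL, hR] at key
  -- left-hand side: `⟪D V v, w'⟫ = ∫ A`
  have hexu : ConvolutionExistsAt kv (zeroExt Q u) (t₀, x₀) (lsmul ℝ ℝ) volume :=
    (hasCompactSupport_of_closedBall hkvr).convolutionExists_left _ hkvc huE _
  have lhs : ⟪fderiv ℝ (stMollify k (zeroExt Q u) t₀) x₀ v, w'⟫ =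
      ∫ z, kv ((t₀, x₀) - z) * ⟪zeroExt Q u z, w'⟫ := by
    rw [fderiv_stMollify_apply hk hkc huE, stMollify_apply, inner_convolution_lsmul_apply hexu,
      convolution_lsmul_apply_eq]
    rfl
  -- right-hand side: `⟪(k ⋆ 𝟙_Q G) v, w'⟫ = ∫ B`
  have hGint : Integrable (fun z => k ((t₀, x₀) - z) • zeroExt Q G z) (volume : Measure (ℝ × E)) :=
    integrable_smul_zeroExt (hk.continuous.comp (continuous_const.sub continuous_id))
      (fun z => hC₀ _) hGi
  have rhs : ⟪stMollify k (zeroExt Q G) t₀ x₀ v, w'⟫ =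
      ∫ z, k ((t₀, x₀) - z) * ⟪zeroExt Q G z v, w'⟫ := by
    rw [stMollify_eq_integral, ContinuousLinearMap.integral_apply hGint v, real_inner_comm,
      ← integral_inner (by exact (ContinuousLinearMap.apply ℝ E v).integrable_comp hGint) w']
    refine integral_congr_ae (Eventually.of_forall fun z => ?_)
    dsimp only
    rw [_root_.FunLike.coe_smul, Pi.smul_apply, real_inner_smul_right, real_inner_comm w']
  rw [lhs, rhs, key]

end MollifiedNS

end Literature.Analysis.FluidPDE
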